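import Summits.BirchSwinnertonDyer.Rank1Residual.X12.CMInertTrace
import Literature.NumberTheory.LFunctions.KroneckerCharacterPrimitive
import Literature.NumberTheory.EllipticCurves.NewformsLiftProofs
import Literature.NumberTheory.EllipticCurves.NewformsProofs
import Literature.NumberTheory.EllipticCurves.IsogenyHasCMIffJMemProofs
import Literature.NumberTheory.EllipticCurves.LFunctionPrimeCoeff
import Literature.NumberTheory.Automorphic.LanglandsTunnellLSeriesProofs
import Literature.NumberTheory.Automorphic.Sweep1
import HarnessLib

/-!
# Route `SignedLowerHalves`, crux L `SmallImageLowerHalfBothSigns` (item stmt-BirchSwinnertonDyer-23599), line `rtt_w3`: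
# the newform of a CM elliptic curve over `ℚ` IS A CM FORM (Ribet's definition `IsCMForm`)

LEAD `cruxlead-stmt-BirchSwinnertonDyer-23599` g2 (cell `bsd-ssimc`); ROUTE-INDEPENDENT helper (`--supports
stmt-BirchSwinnertonDyer-23599`); THEOREMS ONLY — no definition, no named fact, no `sorry`; closes nothing; BSD is not proved by any
of this.

PURPOSE. The T1 branch of the line (CM-CURVE partner `g = f_A`, `A/ℚ` a CM elliptic curve with `A[p] ≃ W[p]`) feeds `f_A` to the
registered stubs Kan₂ / level match, whose partner hypotheses include `IsCMForm (liftToGamma1 M 2 g)` (Ribet: a non-trivial Dirichlet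
character `η` with `η(ℓ) a_ℓ = a_ℓ` for almost all primes `ℓ`). This file proves that clause for the newform of ANY CM elliptic curve
over `ℚ`: `η = χ_{d_K}` the Kronecker character of the CM field `K` (`d_K ∈ {−3,−4,−7,−8,−11,−19,−43,−67,−163}`), and at every prime
`ℓ ∤ 2·d_K·Δ_min(A)·Δ_min(A′)` (`A′ ∼ A` the isogenous curve with CM by `𝓞_K`) either `χ_{d_K}(ℓ) = 1` or `ℓ` is inert in `K` and then
`a_ℓ(A) = a_ℓ(A′) = 0` (Deuring; tree `X12.frobeniusTrace_eq_zero_of_legendreSym_cmFieldDiscr_eq_neg_one`).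

* `isFundamentalDiscriminant_cmFieldDiscr` — `d_K` is a (negative) fundamental discriminant on `maximalCMJInvariants`.
* `heckeEigenvalue_liftToGamma1_eq_cuspCoeff` — `a_ℓ` of the `Γ₁`-lift of a `Γ₀(N)`-newform is its Fourier coefficient.
* `isCMForm_liftToGamma1_of_isNewformOf_of_hasCM` — THE RESULT.

References: [Ribet1977Nebentypus] §3 (Definition, Prop. 4.4); [Lang1987] Ch. 13 §4 Thm. 12 (Deuring); [SilvermanATAEC1994] App. A §3;
[DiamondShurman2005] Prop. 5.8.5; [MontgomeryVaughan2007] §9.3.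
-/

set_option autoImplicit false
-- D-0017: single-problem summit, the namespace repeats the problem name by design.
set_option linter.dupNamespace false
noncomputable section

open scoped Classical MatrixGroups ModularForm

open CongruenceSubgroup WeierstrassCurve Literature.NumberTheory.EllipticCurves
  Literature.NumberTheory.EllipticCurves.ModularForms
  Literature.NumberTheory.LFunctions Literature.NumberTheory.LFunctions.KroneckerCharacter
  Summit.BirchSwinnertonDyer.Rank1Residual.X12

namespace Summit.BirchSwinnertonDyer.BirchSwinnertonDyer.Theorems.SmallImageRttOneSided

/-! ## §1 Two small bridges -/

/-- **`d_K` is a negative fundamental discriminant** for every maximal-order CM `j`-invariant (`cmFieldDiscr_mem`: the nine values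
`{−3,−4,−7,−8,−11,−19,−43,−67,−163}`; nine-way check, as in `GrossZagier1985.isFundamentalDiscriminant_of_mem_cmDiscrs`).
[cite: SilvermanATAEC1994, App. A §3 (first table)] -/
theorem isFundamentalDiscriminant_cmFieldDiscr {j : ℚ} (hj : j ∈ maximalCMJInvariants) :
    cmFieldDiscr j < 0 ∧ Literature.Barriers.RiemannHypothesis.IsFundamentalDiscriminant (cmFieldDiscr j) := by
  have sqf : ∀ p : ℕ, p.Prime → Squarefree (-(p : ℤ)) := fun p hp =>
    (Int.prime_iff_natAbs_prime.2 (by simpa using hp)).neg.squarefree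
  have hd := cmFieldDiscr_mem hj
  generalize cmFieldDiscr j = d at hd ⊢
  simp only [Finset.mem_insert, Finset.mem_singleton] at hd
  rcases hd with rfl | rfl | rfl | rfl | rfl | rfl | rfl | rfl | rfl
  · exact ⟨by norm_num, Or.inl ⟨by decide, by exact_mod_cast sqf 3 (by norm_num), by decide⟩⟩
  · exact ⟨by norm_num, Or.inr ⟨by decide, by decide, by
      rw [show (-4 : ℤ) / 4 = -1 by decide]; exact isUnit_one.neg.squarefree⟩⟩
  · exact ⟨by norm_num, Or.inl ⟨by decide, by exact_mod_cast sqf 7 (by norm_num), by decide⟩⟩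
  · exact ⟨by norm_num, Or.inr ⟨by decide, by decide, by
      rw [show (-8 : ℤ) / 4 = -2 by decide]; exact_mod_cast sqf 2 (by norm_num)⟩⟩
  · exact ⟨by norm_num, Or.inl ⟨by decide, by exact_mod_cast sqf 11 (by norm_num), by decide⟩⟩
  · exact ⟨by norm_num, Or.inl ⟨by decide, by exact_mod_cast sqf 19 (by norm_num), by decide⟩⟩
  · exact ⟨by norm_num, Or.inl ⟨by decide, by exact_mod_cast sqf 43 (by norm_num), by decide⟩⟩
  · exact ⟨by norm_num, Or.inl ⟨by decide, by exact_mod_cast sqf 67 (by norm_num), by decide⟩⟩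
  · exact ⟨by norm_num, Or.inl ⟨by decide, by exact_mod_cast sqf 163 (by norm_num), by decide⟩⟩

/-- **The Hecke eigenvalue of the `Γ₁(N)`-lift of a `Γ₀(N)`-newform at a prime `ℓ` is its `ℓ`-th Fourier coefficient**
(`IsNewform1.heckeEigenvalue_eq_coeff_holds` for the lift, which is a `Γ₁`-newform by `isNewform1_liftToGamma1_iff_holds`, and
`coe_liftToGamma1_holds`). [cite: DiamondShurman2005, Prop. 5.8.5 (1)] -/
theorem heckeEigenvalue_liftToGamma1_eq_cuspCoeff {N : ℕ} [NeZero N] {g : CuspForm (Gamma0 N) 2} (hg : IsNewform0 g)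
    {ℓ : ℕ} (hℓ : ℓ.Prime) : heckeEigenvalue (liftToGamma1 N 2 g) ℓ = cuspCoeff g ℓ := by
  have h1 : IsNewform1 (liftToGamma1 N 2 g) := (isNewform1_liftToGamma1_iff_holds (N := N) (k := 2) g).mpr hg
  rw [IsNewform1.heckeEigenvalue_eq_coeff_holds h1 hℓ, coe_liftToGamma1_holds N 2 g]
  rfl

/-! ## §2 The newform of a CM elliptic curve is a CM form -/

/-- **The newform of a CM elliptic curve over `ℚ` has complex multiplication in Ribet's sense** (`IsCMForm` of its `Γ₁`-lift):
for `A/ℚ` globally minimal with (geometric) CM and `g ∈ S₂(Γ₀(N))` its newform (`IsNewformOf A g`: `a_n(g) = a_n(A)`), the Kronecker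
character `η = χ_{d_K}` of the CM field (`K = End(A_ℚ̄) ⊗ ℚ`, `d_K = cmFieldDiscrOfJ j(A)`) is non-trivial and `η(ℓ)·a_ℓ(g) = a_ℓ(g)`
for every prime `ℓ ∤ 2·d_K·Δ_min(A)·Δ_min(A′)`, where `A′ ∼ A` has CM by `𝓞_K` (tree: `exists_isGloballyMinimal_isIsogenous_maximal_cmFieldDiscr_eq`):
if `η(ℓ) ≠ 1` then `(d_K/ℓ) = −1`, `ℓ` is inert in `K`, and `a_ℓ(g) = a_ℓ(A) = a_ℓ(A′) = 0` (isogeny invariance of `a_ℓ`, Faltings;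
Deuring's theorem at inert primes). [cite: Ribet1977Nebentypus, §3 (Definition) and Prop. 4.4] [cite: Lang1987, Ch. 13 §4 Thm. 12]
[cite: MontgomeryVaughan2007, §9.3] -/
theorem isCMForm_liftToGamma1_of_isNewformOf_of_hasCM (A : WeierstrassCurve ℚ) [A.IsElliptic] [A.IsGloballyMinimal]
    (hcm : A.HasCM) {N : ℕ} [NeZero N] {g : CuspForm (Gamma0 N) 2} (hg : IsNewformOf A g) :
    Literature.NumberTheory.Automorphic.IsCMForm (liftToGamma1 N 2 g) := by
  -- the isogenous maximal-order model `A'` and the CM discriminant `D = d_K`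
  have hjA : A.j ∈ cmJInvariants := (hasCM_iff_j_mem_holds A).mp hcm
  obtain ⟨A', _, _, hiso, hjA', hD'⟩ := exists_isGloballyMinimal_isIsogenous_maximal_cmFieldDiscr_eq A hjA
  set D : ℤ := cmFieldDiscr A'.j with hDdef
  obtain ⟨hDneg, hDfund⟩ := isFundamentalDiscriminant_cmFieldDiscr hjA'
  haveI : NeZero D.natAbs := ⟨Int.natAbs_ne_zero.mpr hDneg.ne⟩
  have hKr := isKroneckerChar_kroneckerChar hDfund
  -- the finite exceptional set: primes dividing `T = 2·|D|·|Δ_min A|·|Δ_min A'|`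
  set T : ℕ := 2 * D.natAbs * (minimalDiscriminantInt A).natAbs * (minimalDiscriminantInt A').natAbs with hTdef
  have hΔA : minimalDiscriminantInt A ≠ 0 := minimalDiscriminantInt_ne_zero A
  have hΔA' : minimalDiscriminantInt A' ≠ 0 := minimalDiscriminantInt_ne_zero A'
  have hT0 : T ≠ 0 := by
    simp only [hTdef]
    refine Nat.mul_ne_zero (Nat.mul_ne_zero (Nat.mul_ne_zero two_ne_zero (NeZero.ne _)) ?_) ?_
    · exact Int.natAbs_ne_zero.mpr hΔA
    · exact Int.natAbs_ne_zero.mpr hΔA'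
  refine ⟨D.natAbs, kroneckerChar D, kroneckerChar_ne_one hDfund, ?_⟩
  rw [Filter.eventually_cofinite]
  refine (Nat.divisors T).finite_toSet.subset fun ℓ hℓ => ?_
  simp only [Set.mem_setOf_eq, Classical.not_imp] at hℓ
  obtain ⟨hℓp, hne⟩ := hℓ
  rw [Finset.mem_coe, Nat.mem_divisors]
  refine ⟨?_, hT0⟩
  by_contra hℓT
  apply hne
  haveI : Fact ℓ.Prime := ⟨hℓp⟩
  -- `ℓ ∤ T`: unpack
  have hℓ2 : ℓ ≠ 2 := by
    rintro rfl; exact hℓT ⟨D.natAbs * (minimalDiscriminantInt A).natAbs * (minimalDiscriminantInt A').natAbs, by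
      simp only [hTdef]; ring⟩
  have hℓD : ¬ (ℓ : ℤ) ∣ D := by
    intro h; apply hℓT
    have h' : ℓ ∣ D.natAbs := Int.natCast_dvd.mp h
    exact h'.trans ⟨2 * (minimalDiscriminantInt A).natAbs * (minimalDiscriminantInt A').natAbs, by
      simp only [hTdef]; ring⟩
  have hℓΔA : ¬ (ℓ : ℤ) ∣ minimalDiscriminantInt A := by
    intro h; apply hℓT
    have h' : ℓ ∣ (minimalDiscriminantInt A).natAbs := Int.natCast_dvd.mp h
    exact h'.trans ⟨2 * D.natAbs * (minimalDiscriminantInt A').natAbs, by simp only [hTdef]; ring⟩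
  have hℓΔA' : ¬ (ℓ : ℤ) ∣ minimalDiscriminantInt A' := by
    intro h; apply hℓT
    have h' : ℓ ∣ (minimalDiscriminantInt A').natAbs := Int.natCast_dvd.mp h
    exact h'.trans ⟨2 * D.natAbs * (minimalDiscriminantInt A).natAbs, by simp only [hTdef]; ring⟩
  have hℓ2D : ¬ (ℓ : ℤ) ∣ 2 * D := by
    intro h
    rcases (Nat.prime_iff_prime_int.mp hℓp).dvd_or_dvd h with h2 | hd
    · exact hℓ2 ((Nat.prime_dvd_prime_iff_eq hℓp Nat.prime_two).mp (by exact_mod_cast h2))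
    · exact hℓD hd
  -- the Hecke eigenvalue of the lift is `a_ℓ(A) = a_ℓ(A')`
  have hgoodA : A.HasGoodReductionAtPrime ℓ := hasGoodReductionAtPrime_of_not_dvd A ℓ hℓΔA
  have hgoodA' : A'.HasGoodReductionAtPrime ℓ := hasGoodReductionAtPrime_of_not_dvd A' ℓ hℓΔA'
  have hev : heckeEigenvalue (liftToGamma1 N 2 g) ℓ = (A'.frobeniusTrace ℓ : ℂ) := by
    rw [heckeEigenvalue_liftToGamma1_eq_cuspCoeff hg.1 hℓp, hg.2 ℓ, A.LFunction_apply_prime_eq_frobeniusTrace ℓ hgoodA,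
      frobeniusTrace_eq_of_isIsogenous hiso ℓ hgoodA hgoodA']
  -- the character value is the Legendre symbol `(D/ℓ)`
  have hη : kroneckerChar D (ℓ : ZMod D.natAbs) = ((legendreSym ℓ D : ℤ) : ℂ) := by
    rw [hKr.2.1 ℓ hℓp hℓ2, jacobiSym.legendreSym.to_jacobiSym]
  rw [hev, hη]
  rcases legendreSym.eq_one_or_neg_one (p := ℓ) (a := D) (by
      intro h0; exact hℓD ((ZMod.intCast_zmod_eq_zero_iff_dvd D ℓ).mp h0)) with h1 | h1
  · rw [h1]; push_cast; ring
  · -- `ℓ` inert in `K`: `a_ℓ(A') = 0`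
    have h0 : A'.frobeniusTrace ℓ = 0 :=
      frobeniusTrace_eq_zero_of_legendreSym_cmFieldDiscr_eq_neg_one A' hjA' ℓ hℓ2D hℓΔA' h1
    rw [h0]; push_cast; ring

end Summit.BirchSwinnertonDyer.BirchSwinnertonDyer.Theorems.SmallImageRttOneSided

end
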